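import Literature.NumberTheory.Automorphic.ArchCellFirstOrderVanishing
import HarnessLib

/-!
# The first-order step of the small-cell analysis: local vanishing, translations by `N`, adapted charts,
# and the step on the group

[cite: Shalika1974, §2, Thm. 2.1]; [cite: HormanderALPDO1, Thm. 2.2.1, Thm. 2.3.4]; [cite: Borel1991, IV.14.12].

Bookkeeping and the chart-free first-order step of Shalika's small-cell analysis on `GL_n(K_∞)` (J. A. Shalika,
*The multiplicity one theorem for `GL_n`*, Ann. of Math. 100 (1974), §2):

* §1 the local-vanishing predicates `VanishesNearAt E e` (for a functional `E` on the functions of the chart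
  parameter space) and `ArchVanishesNear T x` (for a functional `T` on `C_c^∞(GL_n(K_∞))`), localisation
  (`cellPull_eq_zero_of_forall`, Hörmander, Thm. 2.2.1) and the passage between the chart `ẇΨ` and the group
  (`archVanishesNear_of_vanishesNearAt`, `vanishesNearAt_of_archVanishesNear`);
* §2 the translations `leftParamMap`, `rightParamMap` by `N` in coordinates (`ArchBigCellTransport`) are smooth
  with smooth inverses, and the pulled-back functional `E = cellPull (T ∘ λ(ẇ))` of a left/right quasi-invariant
  `T` satisfies `E (g ∘ leftParamMap m) = ψ(u₁)⁻¹ E g` when `ẇ m = u₁ ẇ` with `u₁ ∈ N`, and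
  `E (g ∘ rightParamMap u) = ψ(u)⁻¹ E g`; hence `VanishesNearAt E` is transported along these maps;
* §3 for a chart `ẇ = ẇ(τ)` *adapted to the point at every place* the element `ẇ (1 + X₁) ẇ⁻¹` lies in `N`
  (`adConjGL_multiPermGL_mem_strictUpper`), and the cell `{π''_v X₁ = 0}` is recognised group-theoretically
  in both directions (`mem_bruhatCell_of_piBad_eq_zero`), hence is stable under the translations;
* §4 the first-order step at a general point of an adapted chart (`vanishesNearAt_of_firstOrder`): the special
  case `e₀ = (0, a, 0)` of `ArchCellFirstOrderVanishing` transported along `(X₁, a, X₂) ↦ (0, a, 0)`;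
* §5 the torus coordinate at the place `v` of a point of the cell is chart-independent — it is the Bruhat torus
  coordinate `cellDiag σ` of `BorelBruhatCellsGK` (`placeEmbC_torus_eq_cellDiag`, Borel IV.14.12);
* §6 **the first-order step on the group** (`archVanishesNear_of_firstOrder`): for a distribution `T`, left and
  right quasi-invariant under `U_n(K_∞)`, and a point `y` of the Bruhat cell `B P_σ B` at the place `v` at which
  the first-order datum of a bad pair is non-zero (in any chart over `y`), if `T` vanishes near the points near
  `y` off the cell then `T` vanishes near `y`.

Everything is proved; no new facts.
-/

noncomputable section

open NumberField NumberField.InfinitePlace NumberField.mixedEmbedding Set Filter Matrix Complex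
open Literature.Analysis.Distribution
open scoped MatrixGroups Topology Classical ContDiff Matrix.Norms.Operator ComplexConjugate

namespace Literature.NumberTheory.Automorphic

set_option backward.isDefEq.respectTransparency false

variable {n : ℕ} {K : Type} [Field K] [NumberField K]

local notation "R∞" => mixedSpace K
local notation "Mat" => Matrix (Fin n) (Fin n) (mixedSpace K)
local notation "G∞" => GL (Fin n) (mixedSpace K)
local notation "E∞" => CellParam n (mixedSpace K)
local notation "w₀" => ((weylLong n (mixedSpace K) : GL (Fin n) (mixedSpace K)) : Matrix (Fin n) (Fin n) (mixedSpace K))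

/-- `M_n(K_∞)` is finite-dimensional over `ℝ` (local instance, as in `ArchBigCellDerivatives`). [folklore] -/
private theorem finiteDimensional_matrix_mixedSpace_vt : FiniteDimensional ℝ (Matrix (Fin n) (Fin n) (mixedSpace K)) :=
  Module.Finite.matrix

attribute [local instance] finiteDimensional_matrix_mixedSpace_vt

/-- The parameter space is finite-dimensional over `ℝ` (local instance). [folklore] -/
private theorem finiteDimensional_cellParam_vt : FiniteDimensional ℝ (CellParam n (mixedSpace K)) := by
  unfold CellParam; infer_instance

attribute [local instance] finiteDimensional_cellParam_vt

/-! ### 1. Local vanishing: predicates, localisation, chart versus group -/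

section Local

/-- **`E` vanishes near `e`**: `E g = 0` for the test functions `g` supported in some neighbourhood of `e`.
[folklore] -/
def VanishesNearAt (E : (E∞ → ℂ) → ℂ) (e : E∞) : Prop :=
  ∃ V ∈ 𝓝 e, ∀ g : E∞ → ℂ, IsTestFn g → tsupport g ⊆ V → E g = 0

/-- **`T` vanishes near `x ∈ GL_n(K_∞)`**: `T f = 0` for the test functions `f` supported in some neighbourhood
of `x`. [folklore] -/
def ArchVanishesNear (T : ↥(archTestFunctions n K) →ₗ[ℂ] ℂ) (x : G∞) : Prop :=
  ∃ U ∈ 𝓝 x, ∀ f : ↥(archTestFunctions n K), tsupport (f : G∞ → ℂ) ⊆ U → T f = 0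

/-- The set where `E` vanishes near is open. [folklore] -/
theorem vanishesNearAt_nhds {E : (E∞ → ℂ) → ℂ} {e : E∞} (h : VanishesNearAt E e) : ∀ᶠ e' in 𝓝 e, VanishesNearAt E e' := by
  obtain ⟨V, hV, hE⟩ := h
  obtain ⟨V', hV'V, hV'o, heV'⟩ := mem_nhds_iff.1 hV
  filter_upwards [hV'o.mem_nhds heV'] with e' he'
  exact ⟨V', hV'o.mem_nhds he', fun g hg hgV => hE g hg (hgV.trans hV'V)⟩

variable (T : ↥(archTestFunctions n K) →ₗ[ℂ] ℂ)

/-- **Localisation in the chart** (Hörmander, Thm. 2.2.1): if `cellPull T'` vanishes near every point of the support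
of an admissible `g`, then `cellPull T' g = 0`. [cite: HormanderALPDO1, Thm. 2.2.1] -/
theorem cellPull_eq_zero_of_forall {g : E∞ → ℂ} (hg : IsTestFn g) (hgW : tsupport g ⊆ cellSource n R∞)
    (h : ∀ x ∈ tsupport g, VanishesNearAt (cellPull T) x) : cellPull T g = 0 := by
  refine apply_eq_zero_of_forall_exists_nhds (W := cellSource n R∞) (cellPull_add T) hg hgW fun x hx => ?_
  obtain ⟨V, hV, hE⟩ := h x hx
  exact ⟨V, hV, hE⟩

/-- From pointwise local vanishing off a set `S` near `e₀` to the vanishing on the test functions supported near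
`e₀` off `S`. [folklore] -/
theorem exists_nhds_apply_eq_zero_of_forall {S : Set E∞} {e₀ : E∞} (he₀ : e₀ ∈ cellSource n R∞)
    (h : ∃ V₀ ∈ 𝓝 e₀, ∀ x ∈ V₀, x ∉ S → VanishesNearAt (cellPull T) x) :
    ∃ V₀ ∈ 𝓝 e₀, ∀ g : E∞ → ℂ, IsTestFn g → tsupport g ⊆ V₀ → (∀ x ∈ tsupport g, x ∉ S) → cellPull T g = 0 := by
  obtain ⟨V₀, hV₀, hV⟩ := h
  refine ⟨V₀ ∩ cellSource n R∞, inter_mem hV₀ (isOpen_cellSource.mem_nhds he₀), fun g hg hgV hgS => ?_⟩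
  exact cellPull_eq_zero_of_forall T hg (hgV.trans inter_subset_right) fun x hx => hV x (hgV hx).1 (hgS x hx)

/-- **From the group to the chart**: if `T` vanishes near `ẇ Ψ(e)`, then `cellPull (T ∘ λ(ẇ))` vanishes near `e`.
[folklore] -/
theorem vanishesNearAt_of_archVanishesNear (w : G∞) {e : E∞} (he : e ∈ cellSource n R∞)
    (h : ArchVanishesNear T (w * cellChartGL e he)) : VanishesNearAt (cellPull (T.comp (archTestFunctions.leftTranslate w))) e := by
  obtain ⟨U, hU, hT⟩ := h
  obtain ⟨U', hU'U, hU'o, hxU'⟩ := mem_nhds_iff.1 hU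
  -- the neighbourhood `V = cellSource ∩ {e' : w Ψ(e') ∈ U'}`
  have hopen : IsOpen (((↑) : G∞ → Mat) '' U') := (Units.isOpenEmbedding_val (R := Mat)).isOpenMap _ hU'o
  set V : Set E∞ := cellSource n R∞ ∩ (fun e' => (w : Mat) * cellChart e') ⁻¹' (((↑) : G∞ → Mat) '' U') with hV
  have hVo : IsOpen V := isOpen_cellSource.inter (hopen.preimage (continuous_const.mul contDiff_cellChart.continuous))
  have heV : e ∈ V := ⟨he, ⟨w * cellChartGL e he, hxU', by rw [Units.val_mul, coe_cellChartGL]⟩⟩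
  refine ⟨V, hVo.mem_nhds heV, fun g hg hgV => ?_⟩
  have hgW : tsupport g ⊆ cellSource n R∞ := hgV.trans inter_subset_left
  rw [cellPull_eq _ hg hgW, LinearMap.comp_apply]
  apply hT
  refine (tsupport_leftTranslate_subset w _).trans ?_
  rintro _ ⟨x, hx, rfl⟩
  have hx' := tsupport_cellPush_subset hg.hasCompactSupport (by simpa only [coe_cellPushFn] using hx)
  obtain ⟨e', he', hxe'⟩ := hx'
  obtain ⟨y, hyU', hy⟩ := (hgV he').2
  have : w * x = y := Units.ext (by rw [Units.val_mul, ← hxe', hy])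
  show w * x ∈ U
  rw [this]
  exact hU'U hyU'

/-- The chart pull-back of a group test function supported in the chart image: `g = f ∘ (ẇΨ)` (extension by zero
of `f` composed with `e ↦ ẇ Ψ(e)`). [folklore] -/
def chartPullFn (w : G∞) (f : ↥(archTestFunctions n K)) (e : E∞) : ℂ := archExtZero (f : G∞ → ℂ) ((w : Mat) * cellChart e)

/-- `chartPullFn w f` is smooth. [folklore] -/
theorem contDiff_chartPullFn (w : G∞) (f : ↥(archTestFunctions n K)) : ContDiff ℝ ∞ (chartPullFn w f) :=
  f.2.contDiff_archExtZero.comp (contDiff_const.mul contDiff_cellChart)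

/-- On `cellSource`, `chartPullFn w f e = f (w Ψ(e))`. [folklore] -/
theorem chartPullFn_apply (w : G∞) (f : ↥(archTestFunctions n K)) {e : E∞} (he : e ∈ cellSource n R∞) :
    chartPullFn w f e = (f : G∞ → ℂ) (w * cellChartGL e he) := by
  rw [chartPullFn, ← coe_cellChartGL e he, ← Units.val_mul, archExtZero_coe]

/-- **From the chart to the group**: if `cellPull (T ∘ λ(ẇ))` vanishes near `e ∈ cellSource`, then `T` vanishes
near `ẇ Ψ(e)`. [folklore] -/
theorem archVanishesNear_of_vanishesNearAt (w : G∞) {e : E∞} (he : e ∈ cellSource n R∞)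
    (h : VanishesNearAt (cellPull (T.comp (archTestFunctions.leftTranslate w))) e) :
    ArchVanishesNear T (w * cellChartGL e he) := by
  obtain ⟨V, hV, hE⟩ := h
  -- shrink `V` to a compact neighbourhood inside `cellSource`
  obtain ⟨r, hr, hrV⟩ : ∃ r > 0, Metric.closedBall e r ⊆ V ∩ cellSource n R∞ :=
    Metric.nhds_basis_closedBall.mem_iff.1 (inter_mem hV (isOpen_cellSource.mem_nhds he))
  have hKc : IsCompact (Metric.closedBall e r) := isCompact_closedBall e r
  have hKW : Metric.closedBall e r ⊆ cellSource n R∞ := hrV.trans inter_subset_right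
  -- the neighbourhood `U = w Ψ(ball e r)` of `w Ψ(e)` in the group
  set Φ : E∞ → Mat := fun e' => (w : Mat) * cellChart e' with hΦ
  have hΦc : Continuous Φ := continuous_const.mul contDiff_cellChart.continuous
  set U : Set G∞ := ((↑) : G∞ → Mat) ⁻¹' (Φ '' Metric.ball e r) with hU
  -- `Φ` restricted to `cellSource` is an open map onto its image (a homeomorphism onto `w · big cell`)
  have hUo : IsOpen U := by
    have h1 : Φ '' Metric.ball e r = (fun M : Mat => (w⁻¹ : G∞) * M) ⁻¹' (cellChart '' Metric.ball e r) := by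
      ext M
      constructor
      · rintro ⟨e', he', rfl⟩
        refine ⟨e', he', ?_⟩
        show cellChart e' = ((w⁻¹ : G∞) : Mat) * ((w : Mat) * cellChart e')
        rw [← Matrix.mul_assoc, ← Units.val_mul, inv_mul_cancel, Units.val_one, Matrix.one_mul]
      · rintro ⟨e', he', he'M⟩
        refine ⟨e', he', ?_⟩
        show (w : Mat) * cellChart e' = M
        rw [he'M, ← Matrix.mul_assoc, ← Units.val_mul, mul_inv_cancel, Units.val_one, Matrix.one_mul]
    have h2 : IsOpen (cellChart '' Metric.ball e r : Set Mat) := by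
      have h3 : cellChart '' Metric.ball e r = (cellChartHomeo n R∞) '' Metric.ball e r := rfl
      rw [h3]
      exact (cellChartHomeo n R∞).isOpen_image_of_subset_source Metric.isOpen_ball
        ((Metric.ball_subset_closedBall).trans hKW)
    rw [hU, h1]
    exact (h2.preimage (continuous_const.mul continuous_id)).preimage Units.continuous_val
  have hxU : w * cellChartGL e he ∈ U := ⟨e, Metric.mem_ball_self hr, by rw [hΦ, Units.val_mul, coe_cellChartGL]⟩
  refine ⟨U, hUo.mem_nhds hxU, fun f hf => ?_⟩
  -- `f = λ(w) Ψ_* g` with `g = chartPullFn w f`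
  set g : E∞ → ℂ := chartPullFn w f with hg
  have hgsupp : Function.support g ⊆ Metric.closedBall e r := by
    intro e' he'
    rw [Function.mem_support, hg, chartPullFn] at he'
    -- `w Ψ(e')` is a unit in the support of `f`
    have hunit : IsUnit ((w : Mat) * cellChart e') := by
      by_contra hnu
      exact he' (by rw [archExtZero, dif_neg hnu])
    obtain ⟨y, hy⟩ := hunit
    have hy' : (f : G∞ → ℂ) y ≠ 0 := by rwa [← hy, archExtZero_coe] at he'
    have hyU : y ∈ U := hf (subset_tsupport _ hy')
    obtain ⟨e'', he'', he''y⟩ := hyU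
    -- `Φ e'' = Φ e'` with `e'', e' ∈ cellSource`… first `e' ∈ cellSource`: `cellChart e'` is a unit
    have he's : e' ∈ cellSource n R∞ := by
      have hu : IsUnit (cellChart e') := by
        have : cellChart e' = ((w⁻¹ : G∞) : Mat) * (y : Mat) := by
          rw [hy, ← Matrix.mul_assoc, ← Units.val_mul, inv_mul_cancel, Units.val_one, Matrix.one_mul]
        rw [this, ← Units.val_mul]; exact Units.isUnit _
      exact mem_cellSource_of_isUnit_cellChart hu
    have heq : cellChart e'' = cellChart e' := by
      have h1 : (w : Mat) * cellChart e'' = (w : Mat) * cellChart e' := by rw [← hy]; exact he''y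
      have h2 := congrArg (fun M => ((w⁻¹ : G∞) : Mat) * M) h1
      simpa only [← Matrix.mul_assoc, ← Units.val_mul, inv_mul_cancel, Units.val_one, Matrix.one_mul] using h2
    have : e'' = e' := injOn_cellChart (hKW (Metric.ball_subset_closedBall he'')) he's heq
    rw [← this]
    exact Metric.ball_subset_closedBall he''
  have hgt : IsTestFn g :=
    ⟨contDiff_chartPullFn w f, HasCompactSupport.of_support_subset_isCompact hKc hgsupp⟩
  have hgV : tsupport g ⊆ V :=
    ((closure_minimal hgsupp Metric.isClosed_closedBall).trans hrV).trans inter_subset_left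
  have hgW : tsupport g ⊆ cellSource n R∞ := (closure_minimal hgsupp Metric.isClosed_closedBall).trans hKW
  have hfg : f = archTestFunctions.leftTranslate w (cellPushFn g ⟨hgt, hgW⟩) := by
    apply Subtype.ext
    funext x
    rw [archTestFunctions.leftTranslate_apply, coe_cellPushFn]
    by_cases hx : (((w⁻¹ * x : G∞)) : Mat) ∈ bruhatBigCell n R∞
    · rw [cellPush_apply_of_mem hx, hg, chartPullFn]
      have h1 : (w : Mat) * cellChart ((cellChartHomeo n R∞).symm ((w⁻¹ * x : G∞) : Mat)) = (x : Mat) := by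
        rw [← cellChartHomeo_apply, (cellChartHomeo n R∞).right_inv hx, Units.val_mul, ← Matrix.mul_assoc, ← Units.val_mul,
          mul_inv_cancel, Units.val_one, Matrix.one_mul]
      rw [h1, archExtZero_coe]
    · rw [cellPush_apply_of_not_mem hx]
      by_contra hne
      have hne' : (f : G∞ → ℂ) x ≠ 0 := fun h => hne (by simp [h])
      obtain ⟨e', _, he'x⟩ := hf (subset_tsupport _ hne')
      apply hx
      have : ((w⁻¹ * x : G∞) : Mat) = cellChart e' := by
        rw [Units.val_mul, ← he'x]
        show ((w⁻¹ : G∞) : Mat) * ((w : Mat) * cellChart e') = cellChart e'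
        rw [← Matrix.mul_assoc, ← Units.val_mul, inv_mul_cancel, Units.val_one, Matrix.one_mul]
      rw [this]
      have he's : e' ∈ cellSource n R∞ := hKW (Metric.ball_subset_closedBall ‹_›)
      exact (cellChartHomeo n R∞).map_source he's
  rw [hfg, ← LinearMap.comp_apply, ← cellPull_eq _ hgt hgW]
  exact hE g hgt hgV

end Local

/-! ### 2. Translations by `N` in coordinates and the transport of local vanishing -/

section Param

variable {T : ↥(archTestFunctions n K) →ₗ[ℂ] ℂ}

/-- `ψ_∞(u⁻¹) = ψ_∞(u)⁻¹`. [folklore] -/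
theorem archWhittakerChar_inv_eq (u : ↥(upperUnitriangular (Fin n) R∞)) : archWhittakerChar n K u⁻¹ = (archWhittakerChar n K u)⁻¹ := by
  rw [archWhittakerChar_eq_cexp, archWhittakerChar_eq_cexp, superdiagSum_inv, map_neg, ← Complex.exp_neg]
  congr 1
  push_cast
  ring

/-- `ψ_∞(u) ≠ 0`. [folklore] -/
theorem archWhittakerChar_ne_zero' (u : ↥(upperUnitriangular (Fin n) R∞)) : archWhittakerChar n K u ≠ 0 := by
  rw [archWhittakerChar_eq_cexp]; exact Complex.exp_ne_zero _

/-- **Left quasi-invariance in coordinates**: if `ẇ m = u₁ ẇ` with `m, u₁ ∈ N`, then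
`E (g ∘ leftParamMap m) = ψ(u₁)⁻¹ E g` for `E = cellPull (T ∘ λ(ẇ))`. [folklore] -/
theorem cellPull_comp_leftParamMap
    (hL : ∀ (u : ↥(upperUnitriangular (Fin n) (mixedSpace K))) (f : ↥(archTestFunctions n K)),
      T (archTestFunctions.leftTranslate (u : G∞) f) = archWhittakerChar n K u * T f)
    (w : G∞) (m u₁ : ↥(upperUnitriangular (Fin n) R∞)) (hmu : w * (m : G∞) = (u₁ : G∞) * w)
    {g : E∞ → ℂ} (hg : IsTestFn g) (hgW : tsupport g ⊆ cellSource n R∞) :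
    cellPull (T.comp (archTestFunctions.leftTranslate w)) (g ∘ leftParamMap m) =
      (archWhittakerChar n K u₁)⁻¹ * cellPull (T.comp (archTestFunctions.leftTranslate w)) g := by
  obtain ⟨hg', hgW'⟩ := admissible_comp_leftParamMap m hg hgW
  rw [cellPull_eq _ hg' hgW', cellPull_eq _ hg hgW, LinearMap.comp_apply, LinearMap.comp_apply]
  have hfun : archTestFunctions.leftTranslate w (cellPushFn (g ∘ leftParamMap m) ⟨hg', hgW'⟩) =
      archTestFunctions.leftTranslate ((u₁⁻¹ : ↥(upperUnitriangular (Fin n) R∞)) : G∞)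
        (archTestFunctions.leftTranslate w (cellPushFn g ⟨hg, hgW⟩)) := by
    apply Subtype.ext
    funext x
    simp only [archTestFunctions.leftTranslate_apply, coe_cellPushFn]
    rw [← cellPush_mul_left]
    congr 1
    have hm : (m : G∞) = w⁻¹ * (u₁ : G∞) * w := by rw [mul_assoc, ← hmu, ← mul_assoc, inv_mul_cancel, one_mul]
    rw [hm, Subgroup.coe_inv, inv_inv]
    group
  rw [hfun, hL, archWhittakerChar_inv_eq]

/-- **Right quasi-invariance in coordinates**: `E (g ∘ rightParamMap u) = ψ(u)⁻¹ E g`. [folklore] -/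
theorem cellPull_comp_rightParamMap
    (hR : ∀ (u : ↥(upperUnitriangular (Fin n) (mixedSpace K))) (f : ↥(archTestFunctions n K)),
      T (archTestFunctions.rightTranslate (u : G∞) f) = (archWhittakerChar n K u)⁻¹ * T f)
    (w : G∞) (u : ↥(upperUnitriangular (Fin n) R∞)) {g : E∞ → ℂ} (hg : IsTestFn g) (hgW : tsupport g ⊆ cellSource n R∞) :
    cellPull (T.comp (archTestFunctions.leftTranslate w)) (g ∘ rightParamMap u) =
      (archWhittakerChar n K u)⁻¹ * cellPull (T.comp (archTestFunctions.leftTranslate w)) g := by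
  obtain ⟨hg', hgW'⟩ := admissible_comp_rightParamMap u hg hgW
  rw [cellPull_eq _ hg' hgW', cellPull_eq _ hg hgW, LinearMap.comp_apply, LinearMap.comp_apply]
  have hfun : archTestFunctions.leftTranslate w (cellPushFn (g ∘ rightParamMap u) ⟨hg', hgW'⟩) =
      archTestFunctions.rightTranslate (u : G∞) (archTestFunctions.leftTranslate w (cellPushFn g ⟨hg, hgW⟩)) := by
    apply Subtype.ext
    funext x
    simp only [archTestFunctions.leftTranslate_apply, archTestFunctions.rightTranslate_apply, coe_cellPushFn]
    rw [← cellPush_mul_right, mul_assoc]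
  rw [hfun, hR]

/-- **Transport of local vanishing along a quasi-invariance**: if `E (h ∘ Φ) = c E h` for admissible `h` and
`E` vanishes near `Φ e ∈ cellSource`, then `E` vanishes near `e` (`Φ` a homeomorphism with smooth inverse).
[folklore] -/
theorem vanishesNearAt_of_transport {E : (E∞ → ℂ) → ℂ} (Φ : E∞ ≃ₜ E∞) (hΦs : ContDiff ℝ ∞ (Φ.symm : E∞ → E∞))
    {c : ℂ} (hquasi : ∀ h : E∞ → ℂ, IsTestFn h → tsupport h ⊆ cellSource n R∞ → E (h ∘ Φ) = c * E h)
    {e : E∞} (hΦe : Φ e ∈ cellSource n R∞) (h : VanishesNearAt E (Φ e)) : VanishesNearAt E e := by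
  obtain ⟨V, hV, hE⟩ := h
  refine ⟨Φ ⁻¹' (V ∩ cellSource n R∞), Φ.continuous.continuousAt.preimage_mem_nhds
    (inter_mem hV (isOpen_cellSource.mem_nhds hΦe)), fun g hg hgV => ?_⟩
  set h : E∞ → ℂ := g ∘ Φ.symm with hh
  have hht : IsTestFn h := ⟨hg.contDiff.comp hΦs, hg.hasCompactSupport.comp_homeomorph Φ.symm⟩
  have hhsupp : tsupport h ⊆ V ∩ cellSource n R∞ := by
    have h1 : tsupport h ⊆ Φ.symm ⁻¹' tsupport g := by
      refine closure_minimal ?_ ((isClosed_tsupport g).preimage Φ.symm.continuous)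
      rw [hh, Function.support_comp_eq_preimage]
      exact Set.preimage_mono subset_closure
    intro x hx
    have := hgV (h1 hx)
    rwa [Set.mem_preimage, Φ.apply_symm_apply] at this
  have hgh : g = h ∘ Φ := by funext x; simp [hh]
  rw [hgh, hquasi h hht (hhsupp.trans inter_subset_right), hE h hht (hhsupp.trans inter_subset_left), mul_zero]

/-- The composite translation `(X₁, a, X₂) ↦ leftParamMap m (rightParamMap u (X₁, a, X₂))`. [folklore] -/
def paramHomeo (m u : ↥(upperUnitriangular (Fin n) R∞)) : E∞ ≃ₜ E∞ := (rightParamHomeo u).trans (leftParamHomeo m)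

/-- Unfolding `paramHomeo`. [folklore] -/
theorem paramHomeo_apply (m u : ↥(upperUnitriangular (Fin n) R∞)) (x : E∞) : paramHomeo m u x = leftParamMap m (rightParamMap u x) := rfl

/-- Unfolding the inverse of `paramHomeo`. [folklore] -/
theorem paramHomeo_symm_apply (m u : ↥(upperUnitriangular (Fin n) R∞)) (x : E∞) :
    (paramHomeo m u).symm x = rightParamMap u⁻¹ (leftParamMap m⁻¹ x) := rfl

/-- The inverse of `paramHomeo m u` is smooth. [folklore] -/
theorem contDiff_paramHomeo_symm (m u : ↥(upperUnitriangular (Fin n) R∞)) : ContDiff ℝ ∞ ((paramHomeo m u).symm : E∞ → E∞) := by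
  have h : ((paramHomeo m u).symm : E∞ → E∞) = fun x => rightParamMap u⁻¹ (leftParamMap m⁻¹ x) := funext (paramHomeo_symm_apply m u)
  rw [h]
  exact (contDiff_rightParamMap u⁻¹).comp (contDiff_leftParamMap m⁻¹)

/-- `paramHomeo m u` is smooth. [folklore] -/
theorem contDiff_paramHomeo (m u : ↥(upperUnitriangular (Fin n) R∞)) : ContDiff ℝ ∞ (paramHomeo m u : E∞ → E∞) := by
  have h : (paramHomeo m u : E∞ → E∞) = fun x => leftParamMap m (rightParamMap u x) := funext (paramHomeo_apply m u)
  rw [h]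
  exact (contDiff_leftParamMap m).comp (contDiff_rightParamMap u)

/-- `(paramHomeo m u)⁻¹ = paramHomeo m⁻¹ u⁻¹` up to the order of the two commuting translations. [folklore] -/
theorem paramHomeo_symm_eq (m u : ↥(upperUnitriangular (Fin n) R∞)) (x : E∞) :
    (paramHomeo m u).symm x = paramHomeo m⁻¹ u⁻¹ x := by
  rw [paramHomeo_symm_apply, paramHomeo_apply]
  obtain ⟨X₁, a, X₂⟩ := x
  rfl

/-- `paramHomeo` preserves `cellSource`. [folklore] -/
theorem paramHomeo_mem_cellSource (m u : ↥(upperUnitriangular (Fin n) R∞)) {x : E∞} (hx : x ∈ cellSource n R∞) :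
    paramHomeo m u x ∈ cellSource n R∞ := hx

/-- **`Ψ(paramHomeo m u x) = m Ψ(x) u`.** [folklore] -/
theorem cellChart_paramHomeo (m u : ↥(upperUnitriangular (Fin n) R∞)) (x : E∞) :
    cellChart (paramHomeo m u x) = ((m : G∞) : Mat) * cellChart x * ((u : G∞) : Mat) := by
  rw [paramHomeo_apply, cellChart_leftParamMap, cellChart_rightParamMap, Matrix.mul_assoc]

/-- **Quasi-invariance of `E = cellPull (T ∘ λ(ẇ))` under `paramHomeo m u`** when `ẇ m = u₁ ẇ`. [folklore] -/
theorem cellPull_comp_paramHomeo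
    (hL : ∀ (u : ↥(upperUnitriangular (Fin n) (mixedSpace K))) (f : ↥(archTestFunctions n K)),
      T (archTestFunctions.leftTranslate (u : G∞) f) = archWhittakerChar n K u * T f)
    (hR : ∀ (u : ↥(upperUnitriangular (Fin n) (mixedSpace K))) (f : ↥(archTestFunctions n K)),
      T (archTestFunctions.rightTranslate (u : G∞) f) = (archWhittakerChar n K u)⁻¹ * T f)
    (w : G∞) (m u u₁ : ↥(upperUnitriangular (Fin n) R∞)) (hmu : w * (m : G∞) = (u₁ : G∞) * w)
    {h : E∞ → ℂ} (hh : IsTestFn h) (hhW : tsupport h ⊆ cellSource n R∞) :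
    cellPull (T.comp (archTestFunctions.leftTranslate w)) (h ∘ paramHomeo m u) =
      ((archWhittakerChar n K u)⁻¹ * (archWhittakerChar n K u₁)⁻¹) * cellPull (T.comp (archTestFunctions.leftTranslate w)) h := by
  have hfun : h ∘ paramHomeo m u = (h ∘ leftParamMap m) ∘ rightParamMap u := rfl
  obtain ⟨hh', hhW'⟩ := admissible_comp_leftParamMap m hh hhW
  rw [hfun, cellPull_comp_rightParamMap hR w u hh' hhW', cellPull_comp_leftParamMap hL w m u₁ hmu hh hhW, mul_assoc]

end Param

/-! ### 3. Adapted charts: `ẇ (1 + X₁) ẇ⁻¹ ∈ N`, and the group-theoretic recognition of the cell -/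

section Adapted

variable (v : PlaceIdx K) (σ : Equiv.Perm (Fin n))

/-- **In a chart adapted to the point at every place, `Ad(ẇ) X₁` is strictly upper**: if `X₁` has no bad entry
at any place (`π''_{v'} X₁ = 0` for the permutation `σ'_{v'}` with `τ_{v'} = rev ∘ σ'_{v'}`), then `ẇ X₁ ẇ⁻¹ ∈ 𝔫`.
[folklore] -/
theorem adConjGL_multiPermGL_mem_strictUpper {τ σ' : PlaceIdx K → Equiv.Perm (Fin n)} (hτ : ∀ v', τ v' = Fin.revPerm * σ' v')
    {X : Mat} (hX : X ∈ strictUpper n R∞) (hgood : ∀ v', piBad v' (σ' v') X = 0) :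
    adConjGL (multiPermGL τ) X ∈ strictUpper n R∞ := by
  intro i j hij
  refine eq_zero_iff_placeEmbC.2 fun v' => ?_
  rw [← Matrix.map_apply (f := placeEmbC v') (M := adConjGL (multiPermGL τ) X), adConjGL_map_placeEmbC, placeGL_multiPermGL,
    mul_permGL_inv_apply, permGL_mul_apply, Matrix.map_apply]
  -- the entry `X (ρ i) (ρ j)` at the place `v'`, `ρ = τ_{v'}`
  by_cases hlt : τ v' i < τ v' j
  · -- a bad pair for `σ'_{v'}`: killed by `hgood`
    have hbad : badPair (σ' v') (τ v' i) (τ v' j) := by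
      refine ⟨hlt, ?_⟩
      show patFn (σ' v') (τ v' j) < patFn (σ' v') (τ v' i)
      rw [← perm_symm_eq_patFn (σ' v') (hτ v'), ← perm_symm_eq_patFn (σ' v') (hτ v'), Equiv.symm_apply_apply,
        Equiv.symm_apply_apply]
      exact lt_of_le_of_ne hij (fun h => (ne_of_lt hlt) (by rw [h]))
    exact (piBad_eq_zero_iff v' (σ' v') X).1 (hgood v') _ _ hbad
  · rw [hX _ _ (not_lt.1 hlt), map_zero]

/-- Hence `ẇ (1 + X₁) ẇ⁻¹ ∈ N`. [folklore] -/
theorem conj_unitri_mem_upperUnitriangular {τ σ' : PlaceIdx K → Equiv.Perm (Fin n)} (hτ : ∀ v', τ v' = Fin.revPerm * σ' v')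
    {X : Mat} (hX : X ∈ strictUpper n R∞) (hgood : ∀ v', piBad v' (σ' v') X = 0) :
    (multiPermGL τ : G∞) * unitri X hX * (multiPermGL τ)⁻¹ ∈ upperUnitriangular (Fin n) R∞ := by
  have h : (multiPermGL τ : G∞) * unitri X hX * (multiPermGL τ)⁻¹ =
      unitri (adConjGL (multiPermGL τ) X) (adConjGL_multiPermGL_mem_strictUpper hτ hX hgood) := by
    apply Units.ext
    rw [Units.val_mul, Units.val_mul, coe_unitri, coe_unitri, adConjGL, Matrix.mul_add, Matrix.add_mul, Matrix.mul_one,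
      ← Units.val_mul, mul_inv_cancel, Units.val_one]
  rw [h]
  exact unitri_mem_upperUnitriangular _ _

/-- **Recognition of the cell, converse direction**: if `π''_v X₁ = 0` then `ẇ Ψ(e)` lies in the Bruhat cell
`B P_σ B` at the place `v` (`τ_v = rev ∘ σ`). [folklore] -/
theorem mem_bruhatCell_of_piBad_eq_zero {τ : PlaceIdx K → Equiv.Perm (Fin n)} (hτ : τ v = Fin.revPerm * σ)
    {e : E∞} (he : e ∈ cellSource n R∞) (hb : piBad v σ (e.1 : Mat) = 0) :
    placeGL v (multiPermGL τ * cellChartGL e he) ∈ bruhatCell (K := ℂ) σ := by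
  obtain ⟨⟨X₁, hX₁⟩, a, ⟨X₂, hX₂⟩⟩ := e
  have hX₁' : X₁ ∈ strictUpper n R∞ := hX₁
  have ha : ∀ i, IsUnit (a i) := he
  set U₁ : GL (Fin n) ℂ := placeGL v (unitri X₁ hX₁') with hU₁
  set U₂ : GL (Fin n) ℂ := placeGL v (unitri X₂ (hX₂ : X₂ ∈ strictUpper n R∞)) with hU₂
  set N : GL (Fin n) ℂ := permGL Fin.revPerm * U₁ * permGL Fin.revPerm with hN
  have hfac : placeGL v (multiPermGL τ * cellChartGL (⟨X₁, hX₁⟩, a, ⟨X₂, hX₂⟩) he) =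
      permGL σ * N * diagonalGL (Fin n) ℂ (placeTorus v ha) * U₂ := by
    rw [map_mul, placeGL_multiPermGL, hτ, ← permGL_mul_permGL, cellChartGL, map_mul, map_mul, map_mul, placeGL_weylLong,
      placeGL_diagUnitsGL, hN, hU₁, hU₂]
    simp only [mul_assoc]
  have hNapply : ∀ i j, ((N : GL (Fin n) ℂ) : Matrix (Fin n) (Fin n) ℂ) i j = placeEmbC v ((1 + X₁) i.rev j.rev) := by
    intro i j
    rw [hN, Units.val_mul, Units.val_mul, permGL_mul_mul_permGL_apply, Fin.revPerm_symm, Fin.revPerm_apply, Fin.revPerm_apply,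
      hU₁, placeGL_apply, coe_unitri]
  have hNlow : IsLowerUnitriangular ((N : GL (Fin n) ℂ) : Matrix (Fin n) (Fin n) ℂ) := by
    refine ⟨fun i => ?_, fun i j hij => ?_⟩
    · rw [hNapply, Matrix.add_apply, Matrix.one_apply_eq, hX₁' _ _ le_rfl]; simp
    · rw [hNapply, Matrix.add_apply, Matrix.one_apply, if_neg (fun h => (ne_of_lt hij) (Fin.rev_injective h)),
        hX₁' _ _ (Fin.rev_le_rev.2 hij.le)]
      simp
  rw [hfac]
  refine permGL_mul_mem_bruhatCell_of_entry_eq_zero hNlow (fun k l hkl hσ => ?_) (placeTorus v ha)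
    (placeGL_unitri_mem_upperUnitriangular v X₂ hX₂)
  have hbad : badPair σ k.rev l.rev := ⟨Fin.rev_lt_rev.2 hkl, by rw [Fin.rev_rev, Fin.rev_rev]; exact hσ⟩
  have h := (piBad_eq_zero_iff v σ X₁).1 hb _ _ hbad
  rw [hNapply, Matrix.add_apply, Matrix.one_apply, if_neg (fun h' => (ne_of_lt hkl) (Fin.rev_injective h').symm), zero_add, h]

/-- **The cell in coordinates is `{π''_v X₁ = 0}`** (both directions). [folklore] -/
theorem piBad_eq_zero_iff_mem_bruhatCell {τ : PlaceIdx K → Equiv.Perm (Fin n)} (hτ : τ v = Fin.revPerm * σ)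
    {e : E∞} (he : e ∈ cellSource n R∞) :
    piBad v σ (e.1 : Mat) = 0 ↔ placeGL v (multiPermGL τ * cellChartGL e he) ∈ bruhatCell (K := ℂ) σ :=
  ⟨mem_bruhatCell_of_piBad_eq_zero v σ hτ he, fun h => (projB_eq_zero_iff v σ e).1 (projB_eq_zero_of_mem_bruhatCell v σ hτ he h)⟩

/-- **The cell is stable under the translations `paramHomeo m u` with `ẇ m = u₁ ẇ`, `u₁ ∈ N`.** [folklore] -/
theorem piBad_paramHomeo_eq_zero_iff {τ : PlaceIdx K → Equiv.Perm (Fin n)} (hτ : τ v = Fin.revPerm * σ)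
    (m u u₁ : ↥(upperUnitriangular (Fin n) R∞)) (hmu : (multiPermGL τ : G∞) * (m : G∞) = (u₁ : G∞) * multiPermGL τ)
    {x : E∞} (hx : x ∈ cellSource n R∞) :
    piBad v σ ((paramHomeo m u x).1 : Mat) = 0 ↔ piBad v σ (x.1 : Mat) = 0 := by
  have hx' : paramHomeo m u x ∈ cellSource n R∞ := paramHomeo_mem_cellSource m u hx
  rw [piBad_eq_zero_iff_mem_bruhatCell v σ hτ hx', piBad_eq_zero_iff_mem_bruhatCell v σ hτ hx]
  have hprod : multiPermGL τ * cellChartGL (paramHomeo m u x) hx' = (u₁ : G∞) * (multiPermGL τ * cellChartGL x hx) * (u : G∞) := by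
    apply Units.ext
    simp only [Units.val_mul, coe_cellChartGL, cellChart_paramHomeo, ← Matrix.mul_assoc]
    rw [← Units.val_mul, hmu, Units.val_mul]
  rw [hprod, map_mul, map_mul]
  have hu₁ : placeGL v (u₁ : G∞) ∈ upperUnitriangular (Fin n) ℂ := by
    have h1 : (u₁ : G∞) = unitri (((u₁ : G∞) : Mat) - 1) (sub_one_mem_strictUpper u₁.2) := Units.ext (by rw [coe_unitri, add_sub_cancel])
    rw [h1]; exact placeGL_unitri_mem_upperUnitriangular v _ _
  have hu : placeGL v (u : G∞) ∈ upperUnitriangular (Fin n) ℂ := by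
    have h1 : (u : G∞) = unitri (((u : G∞) : Mat) - 1) (sub_one_mem_strictUpper u.2) := Units.ext (by rw [coe_unitri, add_sub_cancel])
    rw [h1]; exact placeGL_unitri_mem_upperUnitriangular v _ _
  constructor
  · intro h
    have h2 := mul_mul_mem_bruhatCell σ h (Subgroup.inv_mem _ hu₁) (Subgroup.inv_mem _ hu)
    rwa [show (placeGL v (u₁ : G∞))⁻¹ * (placeGL v (u₁ : G∞) * placeGL v (multiPermGL τ * cellChartGL x hx) * placeGL v (u : G∞)) *
        (placeGL v (u : G∞))⁻¹ = placeGL v (multiPermGL τ * cellChartGL x hx) by group] at h2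
  · intro h
    exact mul_mul_mem_bruhatCell σ h hu₁ hu

end Adapted

/-! ### 4. The first-order step at a general point of the cell -/

section General

variable (v : PlaceIdx K) (σ : Equiv.Perm (Fin n)) (i₀ j₀ : Fin n) (θ : mixedSpace K)

/-- The point `(0, a, 0)` with the torus coordinate of `e`. [folklore] -/
def cellBasePoint (e : E∞) : E∞ := (0, e.2.1, 0)

/-- `cellBasePoint e ∈ cellSource` iff `e ∈ cellSource` (same torus coordinate). [folklore] -/
theorem cellBasePoint_mem_cellSource {e : E∞} (he : e ∈ cellSource n R∞) : cellBasePoint e ∈ cellSource n R∞ := he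

/-- The translations moving `e = (X₁, a, X₂)` to `(0, a, 0)`: `m = (1 + X₁)⁻¹`, `u = (1 + X₂)⁻¹`. [folklore] -/
theorem paramHomeo_apply_eq_cellBasePoint (e : E∞) :
    paramHomeo (⟨unitri (e.1 : Mat) e.1.2, unitri_mem_upperUnitriangular _ _⟩ : ↥(upperUnitriangular (Fin n) R∞))⁻¹
      (⟨unitri (e.2.2 : Mat) e.2.2.2, unitri_mem_upperUnitriangular _ _⟩ : ↥(upperUnitriangular (Fin n) R∞))⁻¹ e = cellBasePoint e := by
  obtain ⟨⟨X₁, hX₁⟩, a, ⟨X₂, hX₂⟩⟩ := e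
  rw [paramHomeo_apply, cellBasePoint]
  simp only [rightParamMap, leftParamMap, Subgroup.coe_inv, Prod.mk.injEq, true_and]
  refine ⟨Subtype.ext ?_, Subtype.ext ?_⟩
  · show (((unitri X₁ hX₁)⁻¹ : G∞) : Mat) * (1 + X₁) - 1 = 0
    rw [← coe_unitri X₁ hX₁, ← Units.val_mul, inv_mul_cancel, Units.val_one, sub_self]
  · show (1 + X₂) * (((unitri X₂ hX₂)⁻¹ : G∞) : Mat) - 1 = 0
    rw [← coe_unitri X₂ hX₂, ← Units.val_mul, mul_inv_cancel, Units.val_one, sub_self]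

set_option maxHeartbeats 800000 in
/-- **The first-order step at a general point of the cell.**  Let `T` be a distribution on `GL_n(K_∞)`, left and
right quasi-invariant under `U_n(K_∞)`; `ẇ = ẇ(τ)` a chart with `τ_v = rev ∘ σ` in which the point
`e = (X₁, a, X₂) ∈ cellSource` is adapted (`ẇ (1 + X₁) ẇ⁻¹ ∈ U_n(K_∞)`); `(i₀, j₀)` a bad pair of `σ` and
`θ = 1_v θ` with `dψ(θ E_{f j₀, f i₀}) ≠ dψ((a_{rev j₀}⁻¹ θ a_{rev i₀}) E_{rev j₀, rev i₀})`.  If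
`E = cellPull (T ∘ λ(ẇ))` vanishes near every point near `e` off the cell `{π''_v X₁ = 0}`, then `E` vanishes
near `e`. [cite: Shalika1974, §2, Thm. 2.1] -/
theorem vanishesNearAt_of_firstOrder {T : ↥(archTestFunctions n K) →ₗ[ℂ] ℂ} (hT : IsArchDistribution n K T)
    (hL : ∀ (u : ↥(upperUnitriangular (Fin n) (mixedSpace K))) (f : ↥(archTestFunctions n K)),
      T (archTestFunctions.leftTranslate (u : G∞) f) = archWhittakerChar n K u * T f)
    (hR : ∀ (u : ↥(upperUnitriangular (Fin n) (mixedSpace K))) (f : ↥(archTestFunctions n K)),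
      T (archTestFunctions.rightTranslate (u : G∞) f) = (archWhittakerChar n K u)⁻¹ * T f)
    {τ : PlaceIdx K → Equiv.Perm (Fin n)} (hτ : τ v = Fin.revPerm * σ)
    {e : E∞} (he : e ∈ cellSource n R∞)
    (hadapt : (multiPermGL τ : G∞) * unitri (e.1 : Mat) e.1.2 * (multiPermGL τ)⁻¹ ∈ upperUnitriangular (Fin n) R∞)
    (hbad : badPair σ i₀ j₀) (hθ : (placeIdem v : R∞) * θ = θ)
    (hND : archWhittakerDChar K (patFn σ j₀) (patFn σ i₀) θ ≠
      archWhittakerDChar K j₀.rev i₀.rev (↑((he j₀.rev).unit⁻¹) * θ * e.2.1 i₀.rev))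
    (hvan : ∃ V₀ ∈ 𝓝 e, ∀ x ∈ V₀, x ∈ cellSource n R∞ → piBad v σ (x.1 : Mat) ≠ 0 →
      VanishesNearAt (cellPull (T.comp (archTestFunctions.leftTranslate (multiPermGL τ)))) x) :
    VanishesNearAt (cellPull (T.comp (archTestFunctions.leftTranslate (multiPermGL τ)))) e := by
  -- the translations
  set mX : ↥(upperUnitriangular (Fin n) R∞) := ⟨unitri (e.1 : Mat) e.1.2, unitri_mem_upperUnitriangular _ _⟩ with hmX
  set uX : ↥(upperUnitriangular (Fin n) R∞) := ⟨unitri (e.2.2 : Mat) e.2.2.2, unitri_mem_upperUnitriangular _ _⟩ with huX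
  set U : ↥(upperUnitriangular (Fin n) R∞) := ⟨(multiPermGL τ : G∞) * unitri (e.1 : Mat) e.1.2 * (multiPermGL τ)⁻¹, hadapt⟩ with hU
  -- `ẇ mX⁻¹ = U⁻¹ ẇ` and `ẇ mX = U ẇ`
  have hmu : (multiPermGL τ : G∞) * ((mX⁻¹ : ↥(upperUnitriangular (Fin n) R∞)) : G∞) =
      ((U⁻¹ : ↥(upperUnitriangular (Fin n) R∞)) : G∞) * multiPermGL τ := by
    simp only [Subgroup.coe_inv, hmX, hU]
    group
  have hmu' : (multiPermGL τ : G∞) * ((mX⁻¹⁻¹ : ↥(upperUnitriangular (Fin n) R∞)) : G∞) =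
      ((U⁻¹⁻¹ : ↥(upperUnitriangular (Fin n) R∞)) : G∞) * multiPermGL τ := by
    simp only [inv_inv, hmX, hU]
    group
  set Φ : E∞ ≃ₜ E∞ := paramHomeo mX⁻¹ uX⁻¹ with hΦ
  have hΦe : Φ e = cellBasePoint e := paramHomeo_apply_eq_cellBasePoint e
  have he₀ : cellBasePoint e ∈ cellSource n R∞ := cellBasePoint_mem_cellSource he
  -- quasi-invariance along `Φ` and `Φ⁻¹`
  have hqΦ : ∀ h : E∞ → ℂ, IsTestFn h → tsupport h ⊆ cellSource n R∞ →
      cellPull (T.comp (archTestFunctions.leftTranslate (multiPermGL τ))) (h ∘ Φ) =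
        ((archWhittakerChar n K uX⁻¹)⁻¹ * (archWhittakerChar n K U⁻¹)⁻¹) *
          cellPull (T.comp (archTestFunctions.leftTranslate (multiPermGL τ))) h :=
    fun h hh hhW => cellPull_comp_paramHomeo hL hR (multiPermGL τ) mX⁻¹ uX⁻¹ U⁻¹ hmu hh hhW
  have hqΦ' : ∀ h : E∞ → ℂ, IsTestFn h → tsupport h ⊆ cellSource n R∞ →
      cellPull (T.comp (archTestFunctions.leftTranslate (multiPermGL τ))) (h ∘ Φ.symm) =
        ((archWhittakerChar n K uX⁻¹⁻¹)⁻¹ * (archWhittakerChar n K U⁻¹⁻¹)⁻¹) *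
          cellPull (T.comp (archTestFunctions.leftTranslate (multiPermGL τ))) h := by
    intro h hh hhW
    have hfun : h ∘ Φ.symm = h ∘ paramHomeo mX⁻¹⁻¹ uX⁻¹⁻¹ := funext fun x => by
      simp only [Function.comp_apply, hΦ, paramHomeo_symm_eq]
    rw [hfun]
    exact cellPull_comp_paramHomeo hL hR (multiPermGL τ) mX⁻¹⁻¹ uX⁻¹⁻¹ U⁻¹⁻¹ hmu' hh hhW
  -- the vanishing near the base point off the cell, from `hvan` transported along `Φ`
  have hoffbase : ∃ V₀ ∈ 𝓝 (cellBasePoint e), ∀ x ∈ V₀, x ∉ {x : E∞ | projB v σ x = 0} →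
      VanishesNearAt (cellPull (T.comp (archTestFunctions.leftTranslate (multiPermGL τ)))) x := by
    obtain ⟨V₀, hV₀, hV⟩ := hvan
    have hV₀' : Φ.symm ⁻¹' (V₀ ∩ cellSource n R∞) ∈ 𝓝 (cellBasePoint e) := by
      refine Φ.symm.continuous.continuousAt.preimage_mem_nhds ?_
      rw [← hΦe, Φ.symm_apply_apply]
      exact inter_mem hV₀ (isOpen_cellSource.mem_nhds he)
    refine ⟨_, hV₀', fun x hx hxS => ?_⟩
    obtain ⟨hx1, hx2⟩ := hx
    -- `Φ.symm x` is off the cell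
    have hoff : piBad v σ ((Φ.symm x).1 : Mat) ≠ 0 := by
      intro h0
      apply hxS
      show projB v σ x = 0
      rw [projB_eq_zero_iff]
      have h1 := (piBad_paramHomeo_eq_zero_iff v σ hτ mX⁻¹ uX⁻¹ U⁻¹ hmu hx2).2 h0
      rwa [show paramHomeo mX⁻¹ uX⁻¹ (Φ.symm x) = x from Φ.apply_symm_apply x] at h1
    have h2 : VanishesNearAt (cellPull (T.comp (archTestFunctions.leftTranslate (multiPermGL τ)))) (Φ.symm x) := hV _ hx1 hx2 hoff
    -- transport along `Φ.symm` from `Φ.symm x` to `x`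
    exact vanishesNearAt_of_transport Φ.symm (by simpa only [Homeomorph.symm_symm] using contDiff_paramHomeo mX⁻¹ uX⁻¹) hqΦ'
      (e := x) hx2 h2
  have hvanE : ∃ V₀ ∈ 𝓝 (cellBasePoint e), ∀ g : E∞ → ℂ, IsTestFn g → tsupport g ⊆ V₀ → (∀ x ∈ tsupport g, projB v σ x ≠ 0) →
      cellPull (T.comp (archTestFunctions.leftTranslate (multiPermGL τ))) g = 0 := by
    obtain ⟨V₀, hV₀, h⟩ := exists_nhds_apply_eq_zero_of_forall _ he₀ hoffbase
    exact ⟨V₀, hV₀, fun g hg hgV hgS => h g hg hgV fun x hx => hgS x hx⟩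
  -- Step 2 at the base point
  have hbase : VanishesNearAt (cellPull (T.comp (archTestFunctions.leftTranslate (multiPermGL τ)))) (cellBasePoint e) := by
    obtain ⟨V', hV', hE⟩ := cellPull_leftTranslate_vanish_near v σ i₀ j₀ θ hT hL hR hτ (e₀ := cellBasePoint e) he₀ rfl rfl hbad hθ
      hND hvanE
    exact ⟨V', hV', hE⟩
  -- transport back to `e`
  exact vanishesNearAt_of_transport Φ (contDiff_paramHomeo_symm mX⁻¹ uX⁻¹) hqΦ (by rw [hΦe]; exact he₀) (by rw [hΦe]; exact hbase)

end General

/-! ### 5. The torus coordinate at a place is chart-independent -/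

section Torus

variable (v : PlaceIdx K) (σ : Equiv.Perm (Fin n))

/-- `P_σ N P_σ⁻¹ ∈ U_n` for `N` lower unitriangular vanishing on the pattern `{l < k, σ⁻¹ l < σ⁻¹ k}`. [folklore] -/
theorem conj_permGL_mem_upperUnitriangular {F : Type*} [Field F] {N : GL (Fin n) F}
    (hN : IsLowerUnitriangular (N : Matrix (Fin n) (Fin n) F))
    (hz : ∀ k l : Fin n, l < k → σ.symm l < σ.symm k → (N : Matrix (Fin n) (Fin n) F) k l = 0) :
    permGL σ * N * (permGL σ)⁻¹ ∈ upperUnitriangular (Fin n) F := by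
  rw [mem_upperUnitriangular_iff]
  refine ⟨fun i j hij => ?_, fun i => ?_⟩
  · rw [Units.val_mul, mul_permGL_inv_apply, Units.val_mul, permGL_mul_apply]
    have hij' : j < i := hij
    by_cases hcase : σ j < σ i
    · exact hz _ _ hcase (by simpa using hij')
    · rcases lt_or_eq_of_le (not_lt.1 hcase) with h' | h'
      · exact hN.2 _ _ h'
      · exact absurd (σ.injective h') (ne_of_gt hij')
  · rw [Units.val_mul, mul_permGL_inv_apply, Units.val_mul, permGL_mul_apply, hN.1]

/-- **The factorisation of a chart point at the place `v`**: `(ẇ Ψ(e))_v = P_σ N D U₂` with `N` lower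
unitriangular, `N_{ij} = ((1 + X₁)_{rev i, rev j})_v`, `D = diag(a_v)`, `U₂ = (1 + X₂)_v`. [folklore] -/
theorem placeGL_chart_factorisation {τ : PlaceIdx K → Equiv.Perm (Fin n)} (hτ : τ v = Fin.revPerm * σ)
    {e : E∞} (he : e ∈ cellSource n R∞) :
    ∃ N : GL (Fin n) ℂ, IsLowerUnitriangular (N : Matrix (Fin n) (Fin n) ℂ) ∧
      (∀ i j, (N : Matrix (Fin n) (Fin n) ℂ) i j = placeEmbC v ((1 + (e.1 : Mat)) i.rev j.rev)) ∧
      placeGL v (multiPermGL τ * cellChartGL e he) =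
        permGL σ * N * diagonalGL (Fin n) ℂ (placeTorus v he) * placeGL v (unitri (e.2.2 : Mat) e.2.2.2) := by
  obtain ⟨⟨X₁, hX₁⟩, a, ⟨X₂, hX₂⟩⟩ := e
  have hX₁' : X₁ ∈ strictUpper n R∞ := hX₁
  have ha : ∀ i, IsUnit (a i) := he
  refine ⟨permGL Fin.revPerm * placeGL v (unitri X₁ hX₁') * permGL Fin.revPerm, ?_, ?_, ?_⟩
  · refine ⟨fun i => ?_, fun i j hij => ?_⟩
    · rw [Units.val_mul, Units.val_mul, permGL_mul_mul_permGL_apply, Fin.revPerm_symm, Fin.revPerm_apply,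
        placeGL_apply, coe_unitri, Matrix.add_apply, Matrix.one_apply_eq, hX₁' _ _ le_rfl]
      simp
    · rw [Units.val_mul, Units.val_mul, permGL_mul_mul_permGL_apply, Fin.revPerm_symm, Fin.revPerm_apply, Fin.revPerm_apply,
        placeGL_apply, coe_unitri, Matrix.add_apply, Matrix.one_apply,
        if_neg (fun h => (ne_of_lt hij) (Fin.rev_injective h)), hX₁' _ _ (Fin.rev_le_rev.2 hij.le)]
      simp
  · intro i j
    rw [Units.val_mul, Units.val_mul, permGL_mul_mul_permGL_apply, Fin.revPerm_symm, Fin.revPerm_apply, Fin.revPerm_apply,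
      placeGL_apply, coe_unitri]
  · rw [map_mul, placeGL_multiPermGL, hτ, ← permGL_mul_permGL, cellChartGL, map_mul, map_mul, map_mul, placeGL_weylLong,
      placeGL_diagUnitsGL]
    simp only [mul_assoc]

/-- **The torus coordinate at `v` is the Bruhat torus coordinate**: on the cell,
`(a_i)_v = cellDiag σ ((ẇ Ψ(e))_v) (σ⁻¹ i)`. [cite: Borel1991, IV.14.12] -/
theorem placeEmbC_torus_eq_cellDiag {τ : PlaceIdx K → Equiv.Perm (Fin n)} (hτ : τ v = Fin.revPerm * σ)
    {e : E∞} (he : e ∈ cellSource n R∞) (hb : piBad v σ (e.1 : Mat) = 0) (i : Fin n) :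
    placeEmbC v (e.2.1 i) = cellDiag σ (placeGL v (multiPermGL τ * cellChartGL e he)) (σ.symm i) := by
  obtain ⟨N, hNlow, hNapply, hfac⟩ := placeGL_chart_factorisation v σ hτ he
  have hz : ∀ k l : Fin n, l < k → σ.symm l < σ.symm k → (N : Matrix (Fin n) (Fin n) ℂ) k l = 0 := by
    intro k l hkl hσ
    have hbad : badPair σ k.rev l.rev := ⟨Fin.rev_lt_rev.2 hkl, by rw [Fin.rev_rev, Fin.rev_rev]; exact hσ⟩
    have h := (piBad_eq_zero_iff v σ (e.1 : Mat)).1 hb _ _ hbad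
    rw [hNapply, Matrix.add_apply, Matrix.one_apply, if_neg (fun h' => (ne_of_lt hkl) (Fin.rev_injective h').symm), zero_add, h]
  have hconj := conj_permGL_mem_upperUnitriangular σ hNlow hz
  have hB : permGL σ * diagonalGL (Fin n) ℂ (placeTorus v he) * (permGL σ)⁻¹ ∈ standardParabolicGL ℂ (_root_.id : Fin n → Fin n) := by
    rw [permGL_mul_diagonalGL_mul_permGL_inv]; exact diagonalGL_mem_borel _
  have hb' : permGL σ * N * (permGL σ)⁻¹ * (permGL σ * diagonalGL (Fin n) ℂ (placeTorus v he) * (permGL σ)⁻¹) ∈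
      standardParabolicGL ℂ (_root_.id : Fin n → Fin n) := Subgroup.mul_mem _ (upperUnitriangular_le_borel hconj) hB
  have hrewrite : permGL σ * N * diagonalGL (Fin n) ℂ (placeTorus v he) * placeGL v (unitri (e.2.2 : Mat) e.2.2.2) =
      (permGL σ * N * (permGL σ)⁻¹ * (permGL σ * diagonalGL (Fin n) ℂ (placeTorus v he) * (permGL σ)⁻¹)) * permGL σ *
        placeGL v (unitri (e.2.2 : Mat) e.2.2.2) := by group
  rw [hfac, hrewrite, cellDiag_eq σ hb' (placeGL_unitri_mem_upperUnitriangular v _ _), diagEntries_upperUnitriangular_mul hconj hB,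
    permGL_mul_diagonalGL_mul_permGL_inv, diagEntries, coe_diagonalGL, Matrix.diagonal_apply_eq, Function.comp_apply,
    Equiv.apply_symm_apply]
  rfl

omit [NumberField K] in
/-- **The twisted root coordinate `a_p⁻¹ θ a_q` is chart-independent** for `θ = 1_v θ`: it is determined by the
`v`-components of the torus coordinate. [folklore] -/
theorem torusTwist_eq_of_placeEmbC_eq {θ : R∞} (hθ : (placeIdem v : R∞) * θ = θ) {a a' : Fin n → R∞}
    (ha : ∀ i, IsUnit (a i)) (ha' : ∀ i, IsUnit (a' i)) (h : ∀ i, placeEmbC v (a i) = placeEmbC v (a' i)) (p q : Fin n) :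
    (((ha p).unit⁻¹ : (R∞)ˣ) : R∞) * θ * a q = (((ha' p).unit⁻¹ : (R∞)ˣ) : R∞) * θ * a' q := by
  refine ext_placeEmbC fun v' => ?_
  by_cases hv' : v' = v
  · subst hv'
    rw [map_mul, map_mul, map_mul, map_mul, map_units_inv, map_units_inv, IsUnit.unit_spec, IsUnit.unit_spec, h p, h q]
  · have h0 : placeEmbC v' θ = 0 := by rw [← hθ, placeEmbC_placeIdem_mul, if_neg hv']
    rw [map_mul, map_mul, map_mul, map_mul, h0, mul_zero, zero_mul, mul_zero, zero_mul]

/-- **Two chart points over the same point of the group have the same twisted root coordinates at `v`.**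
[folklore] -/
theorem torusTwist_eq_of_chart_eq {τ τ' : PlaceIdx K → Equiv.Perm (Fin n)} (hτ : τ v = Fin.revPerm * σ) (hτ' : τ' v = Fin.revPerm * σ)
    {e e' : E∞} (he : e ∈ cellSource n R∞) (he' : e' ∈ cellSource n R∞)
    (hy : multiPermGL τ * cellChartGL e he = multiPermGL τ' * cellChartGL e' he')
    (hb : piBad v σ (e.1 : Mat) = 0) {θ : R∞} (hθ : (placeIdem v : R∞) * θ = θ) (p q : Fin n) :
    (((he p).unit⁻¹ : (R∞)ˣ) : R∞) * θ * e.2.1 q = (((he' p).unit⁻¹ : (R∞)ˣ) : R∞) * θ * e'.2.1 q := by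
  have hb' : piBad v σ (e'.1 : Mat) = 0 := by
    rw [piBad_eq_zero_iff_mem_bruhatCell v σ hτ' he', ← hy]
    exact (piBad_eq_zero_iff_mem_bruhatCell v σ hτ he).1 hb
  refine torusTwist_eq_of_placeEmbC_eq v hθ he he' (fun i => ?_) p q
  rw [placeEmbC_torus_eq_cellDiag v σ hτ he hb, placeEmbC_torus_eq_cellDiag v σ hτ' he' hb', hy]

end Torus

/-! ### 6. The first-order step on the group -/

section Group

variable (v : PlaceIdx K) (σ : Equiv.Perm (Fin n)) (i₀ j₀ : Fin n) (θ : mixedSpace K)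

/-- The chart parameter of a point of `ẇ · (big cell)`. [folklore] -/
theorem exists_chart_point {w y : G∞} (hy : ((w⁻¹ * y : G∞) : Mat) ∈ bruhatBigCell n R∞) :
    ∃ (e : E∞) (he : e ∈ cellSource n R∞), w * cellChartGL e he = y := by
  refine ⟨(cellChartHomeo n R∞).symm ((w⁻¹ * y : G∞) : Mat), symm_mem_cellSource hy, Units.ext ?_⟩
  rw [Units.val_mul, coe_cellChartGL, ← cellChartHomeo_apply, (cellChartHomeo n R∞).right_inv hy, Units.val_mul, ← Matrix.mul_assoc,
    ← Units.val_mul, mul_inv_cancel, Units.val_one, Matrix.one_mul]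

/-- **Off-cell vanishing passes from the group to a chart.** [folklore] -/
theorem exists_nhds_vanishesNearAt_of_group {T : ↥(archTestFunctions n K) →ₗ[ℂ] ℂ} {τ : PlaceIdx K → Equiv.Perm (Fin n)}
    (hτ : τ v = Fin.revPerm * σ) {e : E∞} (he : e ∈ cellSource n R∞)
    (hoff : ∃ U ∈ 𝓝 (multiPermGL τ * cellChartGL e he), ∀ y' ∈ U, placeGL v y' ∉ bruhatCell (K := ℂ) σ → ArchVanishesNear T y') :
    ∃ V₀ ∈ 𝓝 e, ∀ x ∈ V₀, x ∈ cellSource n R∞ → piBad v σ (x.1 : Mat) ≠ 0 →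
      VanishesNearAt (cellPull (T.comp (archTestFunctions.leftTranslate (multiPermGL τ)))) x := by
  obtain ⟨U, hU, hT⟩ := hoff
  obtain ⟨U', hU'U, hU'o, hxU'⟩ := mem_nhds_iff.1 hU
  have hopen : IsOpen (((↑) : G∞ → Mat) '' U') := (Units.isOpenEmbedding_val (R := Mat)).isOpenMap _ hU'o
  have hcont : Continuous fun e' : E∞ => ((multiPermGL τ : G∞) : Mat) * cellChart e' := continuous_const.mul contDiff_cellChart.continuous
  refine ⟨(fun e' => ((multiPermGL τ : G∞) : Mat) * cellChart e') ⁻¹' (((↑) : G∞ → Mat) '' U'),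
    (hopen.preimage hcont).mem_nhds ⟨multiPermGL τ * cellChartGL e he, hxU', by rw [Units.val_mul, coe_cellChartGL]⟩,
    fun x hx hxs hxb => ?_⟩
  obtain ⟨y', hy'U', hy'⟩ := hx
  have hy'eq : multiPermGL τ * cellChartGL x hxs = y' := Units.ext (by rw [Units.val_mul, coe_cellChartGL]; exact hy'.symm)
  refine vanishesNearAt_of_archVanishesNear T (multiPermGL τ) hxs (hT _ (by rw [hy'eq]; exact hU'U hy'U') fun hcell => hxb ?_)
  exact (piBad_eq_zero_iff_mem_bruhatCell v σ hτ hxs).2 hcell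

/-- **The first-order step on the group.**  Let `T` be a distribution on `GL_n(K_∞)`, left and right
quasi-invariant under `U_n(K_∞)`, `y` a point of the Bruhat cell `B P_σ B` at the place `v`, `(i₀, j₀)` a bad pair
of `σ` and `θ = 1_v θ` such that, in some chart point `e₀` over `y` (`τ₀_v = rev ∘ σ`),
`dψ(θ E_{f j₀, f i₀}) ≠ dψ((a_{rev j₀}⁻¹ θ a_{rev i₀}) E_{rev j₀, rev i₀})`.  If `T` vanishes near every point near `y`
off the cell, then `T` vanishes near `y`. [cite: Shalika1974, §2, Thm. 2.1] -/
theorem archVanishesNear_of_firstOrder {T : ↥(archTestFunctions n K) →ₗ[ℂ] ℂ} (hT : IsArchDistribution n K T)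
    (hL : ∀ (u : ↥(upperUnitriangular (Fin n) (mixedSpace K))) (f : ↥(archTestFunctions n K)),
      T (archTestFunctions.leftTranslate (u : G∞) f) = archWhittakerChar n K u * T f)
    (hR : ∀ (u : ↥(upperUnitriangular (Fin n) (mixedSpace K))) (f : ↥(archTestFunctions n K)),
      T (archTestFunctions.rightTranslate (u : G∞) f) = (archWhittakerChar n K u)⁻¹ * T f)
    {y : G∞} (hy : placeGL v y ∈ bruhatCell (K := ℂ) σ) (hbad : badPair σ i₀ j₀) (hθ : (placeIdem v : R∞) * θ = θ)
    {τ₀ : PlaceIdx K → Equiv.Perm (Fin n)} (hτ₀ : τ₀ v = Fin.revPerm * σ) {e₀ : E∞} (he₀ : e₀ ∈ cellSource n R∞)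
    (hy₀ : multiPermGL τ₀ * cellChartGL e₀ he₀ = y)
    (hND : archWhittakerDChar K (patFn σ j₀) (patFn σ i₀) θ ≠
      archWhittakerDChar K j₀.rev i₀.rev (↑((he₀ j₀.rev).unit⁻¹) * θ * e₀.2.1 i₀.rev))
    (hoff : ∃ U ∈ 𝓝 y, ∀ y' ∈ U, placeGL v y' ∉ bruhatCell (K := ℂ) σ → ArchVanishesNear T y') :
    ArchVanishesNear T y := by
  -- a chart adapted to `y` at every place, with `σ'_v = σ`
  set σ' : PlaceIdx K → Equiv.Perm (Fin n) := fun v' => if v' = v then σ else (exists_mem_bruhatCell (placeGL v' y)).choose with hσ'def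
  have hσ'v : σ' v = σ := by simp [hσ'def]
  have hσ' : ∀ v', placeGL v' y ∈ bruhatCell (K := ℂ) (σ' v') := by
    intro v'
    by_cases h : v' = v
    · subst h; rw [hσ'v]; exact hy
    · simp only [hσ'def, h, if_false]; exact (exists_mem_bruhatCell (placeGL v' y)).choose_spec
  set τ' : PlaceIdx K → Equiv.Perm (Fin n) := fun v' => Fin.revPerm * σ' v' with hτ'def
  have hτ' : ∀ v', τ' v' = Fin.revPerm * σ' v' := fun _ => rfl
  have hτ'v : τ' v = Fin.revPerm * σ := by rw [hτ', hσ'v]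
  have hbig : (((multiPermGL τ' : G∞)⁻¹ * y : G∞) : Mat) ∈ bruhatBigCell n R∞ := inv_multiPermGL_mul_mem_bruhatBigCell y σ' hσ'
  obtain ⟨e, he, hye⟩ := exists_chart_point hbig
  -- `e` is adapted at every place
  have hgood : ∀ v', piBad v' (σ' v') (e.1 : Mat) = 0 := fun v' =>
    (projB_eq_zero_iff v' (σ' v') e).1 (projB_eq_zero_of_mem_bruhatCell v' (σ' v') (hτ' v') he (by rw [hye]; exact hσ' v'))
  have hadapt : (multiPermGL τ' : G∞) * unitri (e.1 : Mat) e.1.2 * (multiPermGL τ')⁻¹ ∈ upperUnitriangular (Fin n) R∞ :=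
    conj_unitri_mem_upperUnitriangular hτ' e.1.2 hgood
  -- the non-degeneracy datum in the chart `τ'`
  have hb₀ : piBad v σ (e₀.1 : Mat) = 0 :=
    (piBad_eq_zero_iff_mem_bruhatCell v σ hτ₀ he₀).2 (by rw [hy₀]; exact hy)
  have htw := torusTwist_eq_of_chart_eq v σ hτ₀ hτ'v he₀ he (hy₀.trans hye.symm) hb₀ hθ j₀.rev i₀.rev
  have hND' : archWhittakerDChar K (patFn σ j₀) (patFn σ i₀) θ ≠
      archWhittakerDChar K j₀.rev i₀.rev (↑((he j₀.rev).unit⁻¹) * θ * e.2.1 i₀.rev) := by rwa [← htw]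
  -- the off-cell vanishing in the chart `τ'`
  have hvan := exists_nhds_vanishesNearAt_of_group v σ (T := T) hτ'v he (by rw [hye]; exact hoff)
  -- the first-order step in the chart, and back to the group
  have h := vanishesNearAt_of_firstOrder v σ i₀ j₀ θ hT hL hR hτ'v he hadapt hbad hθ hND' hvan
  rw [← hye]
  exact archVanishesNear_of_vanishesNearAt T (multiPermGL τ') he h

end Group

end Literature.NumberTheory.Automorphic
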